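import Literature.RingTheory.MvPolynomial.OstrowskiElimination
import Mathlib.LinearAlgebra.Matrix.Rank
import Mathlib.LinearAlgebra.Matrix.ToLinearEquiv
import Mathlib.LinearAlgebra.Matrix.NonsingularInverse
import Mathlib.Algebra.Order.Antidiag.FinsuppEquiv
import Mathlib.Data.Nat.Choose.Sum
import Mathlib.Algebra.MvPolynomial.Equiv
import Mathlib.Algebra.MvPolynomial.NoZeroDivisors
import Mathlib.FieldTheory.IsAlgClosed.Basic
import HarnessLib

/-!
# Proof of Ostrowski's theorem (Schmidt, *Equations over finite fields*, Ch. V, Thm. 2A, Cor. 2B)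

This file discharges the named fact
`Literature.RingTheory.MvPolynomial.ostrowski1919_absIrreducible_reduction`
(`AbsoluteIrreducibilityReduction.lean`) as `ostrowski1919_absIrreducible_reduction_holds`. Two parts:

1. **Theorem 2A** (E. Noether's irreducibility forms with Schmidt's bounds): `noether_forms_exist`;
2. **Corollary 2B** (Ostrowski 1919): the reduction modulo `p > (4‖f‖)^{k^{2^k}}` of an absolutely
   irreducible `f ∈ ℤ[X₁, …, Xₙ]` of degree `d` is absolutely irreducible of degree `d`.

Support files: `OstrowskiNorms` (Schmidt's norm `‖·‖`), `OstrowskiResultant` (resultants: isobaric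
property, norm), `OstrowskiElimination` (Lemma 1C, generic forms, Thms. 1A, 1D).
No new definitions. Each part has its own commentary below.
-/

/-!
## Part 1. Noether's irreducibility forms (Schmidt Ch. V, Theorem 2A)

Support file for the proof of Ostrowski's theorem
(`Literature.RingTheory.MvPolynomial.ostrowski1919_absIrreducible_reduction`, Schmidt,
*Equations over finite fields*, Ch. V, Cor. 2B).

**Theorem 2A** (E. Noether 1922; Schmidt Ch. V §2): there are forms `g₁, …, g_s` with integer
coefficients in the coefficients `a_{i₁…i_n}` of the general polynomial `f` of degree `≤ d` in `n`
variables such that, over any algebraically closed field, `f` is reducible or of degree `< d` iff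
all `g_j(a) = 0`; with `k = C(n+d-1, n)`, `deg g_j ≤ k^{2^k}` and `‖g_j‖ ≤ 4^{k^{2^k}}`.

We follow Schmidt's proof: "`f` is reducible or `deg f < d` iff `f = gh` with `deg g, deg h < d`";
for fixed `g ≠ 0` the condition "`c f = g h` has a non-trivial solution `(c, h)`" is the linear
system (2.2) `c a_i = Σ_{j+k=i} b_j c_k` in the `k + 1` unknowns `(c, c_k)`, `k = C(n+d-1, n)` the
number of monomials of degree `≤ d - 1`; it has a non-trivial solution iff all
`(k+1) × (k+1)` minors `Δ` vanish (`exists_mulVec_eq_zero_iff_forall_det_submatrix`); each `Δ` is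
a form of degree `k` in the `k` coefficients `b` of `g` and linear in the `a`'s
(`noetherMinor_isWeightedHomogeneous`), so Theorem 1A/1D (`elimination_main_type`) applied to the
`Δ`'s, followed by the substitution of their coefficients (Lemmas 1B/1E; "each such coefficient is
linear in the `a`'s with norm at most `k!`" — we use the cruder `(k+1)!`, `l1Norm_noetherMinor_le`)
gives the forms (`noether_forms_exist`). Here `d = e + 1` with `e ≥ 1` and `n = N ≥ 1`; the
reducibility condition is rendered as
`∃ g h c, g ≠ 0 ∧ (c ≠ 0 ∨ h ≠ 0) ∧ deg g ≤ e ∧ deg h ≤ e ∧ c f = g h` (Schmidt's (2.2) with its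
non-triviality), and `k` is `C(N + e, N)` (`card_monomialsLE`). The numerical bounds are kept in the
recursive shape `2^{k-1} k^{2^{k-1}-1}` / `2^{(2k+1)2^{k-1}k^{2^{k-1}}} ((k+1)!)^{…}` delivered by
Thms. 1A/1D; the comparison with `k^{2^k}` and `4^{k^{2^k}}` is done where Cor. 2B is proved.

No new definitions.

## References

* W. M. Schmidt, *Equations over finite fields. An elementary approach*, LNM 536 (1976),
  2nd ed. (2004), Ch. V §2, Theorem 2A (pp. 99–100 of the 2nd ed.). [`Schmidt1976`]
* E. Noether, *Ein algebraisches Kriterium für absolute Irreduzibilität*, Math. Ann. 85 (1922)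
  26–33.
-/

noncomputable section

open MvPolynomial

namespace Literature.RingTheory.MvPolynomial

/-! ### Maximal minors and non-trivial solutions -/

section LinearAlgebra

/-- A matrix with finitely many rows and columns over a field kills a non-zero vector iff all
its maximal square row-submatrices are singular ("the condition … is that all the
`(k+1) × (k+1)` determinants … vanish", Schmidt, proof of Thm. 2A). [cite: Schmidt1976, Ch. V Thm. 2A (proof)] -/
theorem exists_mulVec_eq_zero_iff_forall_det_submatrix {L : Type*} [Field L] {E C : Type*}
    [Fintype E] [Fintype C] [DecidableEq E] [DecidableEq C] (M : Matrix E C L) :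
    (∃ w : C → L, w ≠ 0 ∧ M.mulVec w = 0) ↔ ∀ ρ : C → E, (M.submatrix ρ id).det = 0 := by
  constructor
  · rintro ⟨w, hw, hMw⟩ ρ
    apply Matrix.exists_mulVec_eq_zero_iff.mp
    refine ⟨w, hw, ?_⟩
    funext c
    have := congr_fun hMw (ρ c)
    simpa [Matrix.mulVec, Matrix.submatrix] using this
  · intro h
    by_contra hne
    push Not at hne
    have hinj : Function.Injective M.mulVec := by
      intro w₁ w₂ h12
      by_contra hw
      exact hne (w₁ - w₂) (sub_ne_zero.mpr hw) (by rw [Matrix.mulVec_sub, h12, sub_self])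
    have hrank : M.rank = Fintype.card C := by
      rw [Matrix.rank, LinearMap.finrank_range_of_inj (by exact hinj),
        Module.finrank_fintype_fun_eq_card]
    obtain ⟨κ, ι, hι, hspan, hli⟩ := exists_linearIndependent' L M.row
    haveI : Fintype κ := Fintype.ofInjective ι hι
    have hcard : Fintype.card κ = Fintype.card C := by
      rw [← finrank_span_eq_card hli, hspan, ← Matrix.rank_eq_finrank_span_row, hrank]
    obtain ⟨σ⟩ : Nonempty (C ≃ κ) := Fintype.card_eq.mp hcard.symm
    have hli' : LinearIndependent L (M.submatrix (ι ∘ σ) id).row := hli.comp σ σ.injective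
    have hunit := Matrix.linearIndependent_rows_iff_isUnit.mp hli'
    rw [Matrix.isUnit_iff_isUnit_det] at hunit
    exact hunit.ne_zero (h _)

end LinearAlgebra

/-! ### Two-block slices: a polynomial in `ℤ[A, B]` as a form in `B` with coefficients in `ℤ[A]` -/

section TwoBlocks

variable {α β : Type*}

/-- The weight of an exponent vector for `A ↦ (1, 0)`, `B ↦ (0, 1)` is `(deg_A, deg_B)`.
[folklore] -/
theorem weight_gradingAB (w : (α ⊕ β) →₀ ℕ) :
    Finsupp.weight (Sum.elim (fun _ : α => ((1 : ℕ), (0 : ℕ))) (fun _ : β => ((0 : ℕ), (1 : ℕ)))) w =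
      ((Finsupp.comapDomain Sum.inl w Sum.inl_injective.injOn).degree,
        (Finsupp.comapDomain Sum.inr w Sum.inr_injective.injOn).degree) := by
  classical
  conv_lhs => rw [← Finsupp.comapDomain_sumElim_comapDomain w]
  rw [Finsupp.weight_apply, Finsupp.sum_sumElim]
  simp only [Function.comp_def, Sum.elim_inl, Sum.elim_inr, Finsupp.sum, Finsupp.degree_apply]
  ext <;> simp [Prod.fst_sum, Prod.snd_sum]

/-- Norm of a `B`-slice `Σ_{w : w_B = μ} (coeff_w P) A^{w_A}`: at most `‖P‖`. [folklore] -/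
theorem l1Norm_sliceB_le (P : MvPolynomial (α ⊕ β) ℤ) (q : ((α ⊕ β) →₀ ℕ) → Prop)
    [DecidablePred q] :
    l1Norm (∑ w ∈ P.support with q w,
      monomial (Finsupp.comapDomain Sum.inl w Sum.inl_injective.injOn) (coeff w P)) ≤ l1Norm P := by
  refine (l1Norm_sum_le _ _).trans ?_
  simp only [l1Norm_monomial]
  exact Finset.sum_le_sum_of_subset (Finset.filter_subset _ _)

/-- Degree of a `B`-slice: at most `D` if all `A`-parts have degree `≤ D`. [folklore] -/
theorem totalDegree_sliceB_le (P : MvPolynomial (α ⊕ β) ℤ) (q : ((α ⊕ β) →₀ ℕ) → Prop)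
    [DecidablePred q] (D : ℕ)
    (hD : ∀ w ∈ P.support, (Finsupp.comapDomain Sum.inl w Sum.inl_injective.injOn).degree ≤ D) :
    (∑ w ∈ P.support with q w,
      monomial (Finsupp.comapDomain Sum.inl w Sum.inl_injective.injOn) (coeff w P)).totalDegree
      ≤ D := by
  refine totalDegree_finsetSum_le fun w hw => (totalDegree_monomial_le _ _).trans ?_
  rw [Finset.mem_filter] at hw
  exact le_of_eq_of_le (Finsupp.degree_apply _).symm (hD w hw.1)

/-- **Evaluating through the slices**: if all monomials of `P ∈ ℤ[A, B]` have `B`-degree `k`, then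
`P(a, b) = Σ_{|μ| = k} slice_μ(P)(a) · b^μ` — `P` as a form of degree `k` in `B` whose coefficients
are integer polynomials in `A` ("each `Δᵢ` is a form in the coefficients `b` of degree `k`",
Schmidt, proof of Thm. 2A). [cite: Schmidt1976, Ch. V Thm. 2A (proof)] -/
theorem aeval_eq_sum_sliceB {L : Type*} [CommRing L] [Fintype β] [DecidableEq β] [DecidableEq α]
    (P : MvPolynomial (α ⊕ β) ℤ) (a : α → L) (b : β → L) (k : ℕ)
    (hP : ∀ w ∈ P.support, (Finsupp.comapDomain Sum.inr w Sum.inr_injective.injOn).degree = k) :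
    aeval (Sum.elim a b) P =
      ∑ μ ∈ (Finset.univ : Finset β).finsuppAntidiag k,
        aeval a (∑ w ∈ P.support with Finsupp.comapDomain Sum.inr w Sum.inr_injective.injOn = μ,
          monomial (Finsupp.comapDomain Sum.inl w Sum.inl_injective.injOn) (coeff w P)) *
        ∏ t, b t ^ μ t := by
  classical
  let πA : ((α ⊕ β) →₀ ℕ) → (α →₀ ℕ) := fun w => Finsupp.comapDomain Sum.inl w Sum.inl_injective.injOn
  let πB : ((α ⊕ β) →₀ ℕ) → (β →₀ ℕ) := fun w => Finsupp.comapDomain Sum.inr w Sum.inr_injective.injOn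
  let cL : ((α ⊕ β) →₀ ℕ) → L := fun w =>
    ((coeff w P : ℤ) : L) * (πA w).prod (fun y e => a y ^ e) * ∏ t, b t ^ πB w t
  have hterm : ∀ w, aeval (Sum.elim a b) (monomial w (coeff w P)) = cL w := by
    intro w
    have hw : w = (πA w).sumElim (πB w) := (Finsupp.comapDomain_sumElim_comapDomain w).symm
    have : monomial w (coeff w P) = monomial ((πA w).sumElim (πB w)) (coeff w P) :=
      congr_arg (monomial · (coeff w P)) hw
    rw [this, aeval_monomial, Finsupp.prod_sumElim]
    simp only [cL, Function.comp_def, Sum.elim_inl, Sum.elim_inr, algebraMap_int_eq, eq_intCast,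
      Finsupp.prod_pow]
    ring
  have hL : aeval (Sum.elim a b) P = ∑ w ∈ P.support, cL w := by
    conv_lhs => rw [P.as_sum]
    rw [map_sum]
    exact Finset.sum_congr rfl fun w _ => hterm w
  rw [hL]
  change ∑ w ∈ P.support, cL w =
    ∑ μ ∈ (Finset.univ : Finset β).finsuppAntidiag k,
      aeval a (∑ w ∈ P.support with πB w = μ, monomial (πA w) (coeff w P)) * ∏ t, b t ^ μ t
  have hmaps : ∀ w ∈ P.support, πB w ∈ (Finset.univ : Finset β).finsuppAntidiag k :=
    fun w hw => mem_finsuppAntidiag_of_degree_eq (hP w hw)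
  rw [← Finset.sum_fiberwise_of_maps_to hmaps]
  refine Finset.sum_congr rfl fun μ _ => ?_
  rw [map_sum, Finset.sum_mul]
  refine Finset.sum_congr rfl fun w hw => ?_
  rw [Finset.mem_filter] at hw
  rw [aeval_monomial, ← hw.2]
  simp only [cL, algebraMap_int_eq, eq_intCast]

end TwoBlocks

/-! ### Norm of a determinant with small entries -/

section DetNorm

/-- `‖det M‖ ≤ (#rows)!` when all entries have norm `≤ 1` (each of the `(k+1)!` terms of the
determinant is, up to sign, a product of entries). [cite: Schmidt1976, Ch. V Thm. 2A (proof)] -/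
theorem l1Norm_det_le_factorial {σ ι : Type*} [Fintype ι] [DecidableEq ι]
    (M : Matrix ι ι (MvPolynomial σ ℤ)) (hM : ∀ i j, l1Norm (M i j) ≤ 1) :
    l1Norm M.det ≤ (Fintype.card ι).factorial := by
  rw [Matrix.det_apply']
  refine (l1Norm_sum_le _ _).trans ?_
  calc ∑ π : Equiv.Perm ι, l1Norm (((Equiv.Perm.sign π : ℤ) : MvPolynomial σ ℤ) * ∏ i, M (π i) i)
        ≤ ∑ _π : Equiv.Perm ι, 1 := by
          refine Finset.sum_le_sum fun π _ => ?_
          rw [← map_intCast (C : ℤ →+* MvPolynomial σ ℤ), Int.cast_id]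
          refine (l1Norm_mul_le _ _).trans ?_
          rw [l1Norm_C, Int.units_natAbs, one_mul]
          refine (l1Norm_prod_le _ _).trans ?_
          exact Finset.prod_le_one (fun _ _ => Nat.zero_le _) fun i _ => hM _ _
    _ = (Fintype.card ι).factorial := by
          rw [Finset.sum_const, Finset.card_univ, Fintype.card_perm, smul_eq_mul, mul_one]

end DetNorm


/-! ### Monomials of bounded degree -/

section Monomials

variable {N : ℕ}

/-- Membership in the set of exponent vectors of degree `≤ x`. [folklore] -/
theorem mem_monomialsLE {x : ℕ} {m : Fin N →₀ ℕ} :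
    m ∈ ((Finset.range (x + 1)).biUnion fun i => (Finset.univ : Finset (Fin N)).finsuppAntidiag i) ↔ m.degree ≤ x := by
  simp only [Finset.mem_biUnion, Finset.mem_range, Nat.lt_succ_iff]
  constructor
  · rintro ⟨i, hi, hm⟩
    exact (degree_eq_of_mem_finsuppAntidiag hm).le.trans hi
  · intro h
    exact ⟨m.degree, h, mem_finsuppAntidiag_of_degree_eq rfl⟩

/-- **The count `k = C(n+d-1, n)`**: the number of monomials of degree `≤ e` in `N ≥ 1` variables
is `C(N + e, N)` (Schmidt: "the number of variables is `k + 1` with `k = C(n+d-1, n)`", `d = e + 1`).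
[cite: Schmidt1976, Ch. V Thm. 2A (proof)] -/
theorem card_monomialsLE (hN : 1 ≤ N) (e : ℕ) :
    (((Finset.range (e + 1)).biUnion fun i => (Finset.univ : Finset (Fin N)).finsuppAntidiag i)).card = (N + e).choose N := by
  rw [Finset.card_biUnion]
  · have h : ∀ i ∈ Finset.range (e + 1),
        ((Finset.univ : Finset (Fin N)).finsuppAntidiag i).card = (i + (N - 1)).choose (N - 1) := by
      intro i _
      rw [Finset.card_finsuppAntidiag_nat_eq_choose, Finset.card_univ, Fintype.card_fin]
      rw [show N + i - 1 = i + (N - 1) by omega]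
      exact Nat.choose_symm_of_eq_add rfl
    rw [Finset.sum_congr rfl h, Nat.sum_range_add_choose]
    rw [show e + (N - 1) + 1 = N + e by omega, show N - 1 + 1 = N by omega]
  · intro i _ j _ hij
    rw [Function.onFun, Finset.disjoint_left]
    intro m hmi hmj
    exact hij ((degree_eq_of_mem_finsuppAntidiag hmi).symm.trans (degree_eq_of_mem_finsuppAntidiag hmj))

/-- A polynomial of degree `≤ e` is the sum of its terms of degree `≤ e`. [folklore] -/
theorem eq_sum_monomial_of_totalDegree_le {R : Type*} [CommSemiring R] {e : ℕ}
    (g : MvPolynomial (Fin N) R) (hg : g.totalDegree ≤ e) :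
    g = ∑ κ : ↥((Finset.range (e + 1)).biUnion fun i => (Finset.univ : Finset (Fin N)).finsuppAntidiag i), monomial κ.1 (coeff κ.1 g) := by
  classical
  ext i
  rw [coeff_sum]
  simp only [coeff_monomial]
  by_cases hi : i ∈ ((Finset.range (e + 1)).biUnion fun i => (Finset.univ : Finset (Fin N)).finsuppAntidiag i)
  · rw [Finset.sum_eq_single ⟨i, hi⟩]
    · simp
    · intro κ _ hκ
      rw [if_neg]
      exact fun h => hκ (Subtype.ext h)
    · simp
  · rw [Finset.sum_eq_zero]
    · rw [mem_monomialsLE, not_le] at hi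
      by_contra hne
      have h1 := le_totalDegree (mem_support_iff.mpr hne)
      have h2 : (i.sum fun _ e => e) = i.degree := by rw [Finsupp.degree_apply, Finsupp.sum]
      omega
    · intro κ _
      rw [if_neg]
      rintro rfl
      exact hi κ.2

/-- The coefficients of `Σ_κ b_κ X^κ` (`κ` over the monomials of degree `≤ e`). [folklore] -/
theorem coeff_sum_monomial_subtype {R : Type*} [CommSemiring R] {e : ℕ} (b : ↥((Finset.range (e + 1)).biUnion fun i => (Finset.univ : Finset (Fin N)).finsuppAntidiag i) → R)
    (κ : ↥((Finset.range (e + 1)).biUnion fun i => (Finset.univ : Finset (Fin N)).finsuppAntidiag i)) :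
    coeff κ.1 (∑ κ' : ↥((Finset.range (e + 1)).biUnion fun i => (Finset.univ : Finset (Fin N)).finsuppAntidiag i), monomial κ'.1 (b κ') : MvPolynomial (Fin N) R) = b κ := by
  classical
  rw [coeff_sum]
  simp only [coeff_monomial]
  rw [Finset.sum_eq_single κ]
  · simp
  · intro κ' _ hκ'
    rw [if_neg]
    exact fun h => hκ' (Subtype.ext h)
  · simp

/-- `Σ_κ b_κ X^κ` has degree `≤ e`. [folklore] -/
theorem totalDegree_sum_monomial_subtype_le {R : Type*} [CommSemiring R] {e : ℕ}
    (b : ↥((Finset.range (e + 1)).biUnion fun i => (Finset.univ : Finset (Fin N)).finsuppAntidiag i) → R) :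
    (∑ κ : ↥((Finset.range (e + 1)).biUnion fun i => (Finset.univ : Finset (Fin N)).finsuppAntidiag i), monomial κ.1 (b κ) : MvPolynomial (Fin N) R).totalDegree ≤ e :=
  totalDegree_finsetSum_le fun κ _ => (totalDegree_monomial_le _ _).trans
    (le_of_eq_of_le (Finsupp.degree_apply _).symm (mem_monomialsLE.mp κ.2))

/-- `Σ_κ b_κ X^κ = 0` iff `b = 0`. [folklore] -/
theorem sum_monomial_subtype_eq_zero_iff {R : Type*} [CommSemiring R] {e : ℕ}
    (b : ↥((Finset.range (e + 1)).biUnion fun i => (Finset.univ : Finset (Fin N)).finsuppAntidiag i) → R) :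
    (∑ κ : ↥((Finset.range (e + 1)).biUnion fun i => (Finset.univ : Finset (Fin N)).finsuppAntidiag i), monomial κ.1 (b κ) : MvPolynomial (Fin N) R) = 0 ↔ b = 0 := by
  constructor
  · intro h
    funext κ
    rw [← coeff_sum_monomial_subtype b κ, h, coeff_zero]
    rfl
  · rintro rfl
    simp

end Monomials


/-! ### The linear system (2.2) -/

section System

variable {N : ℕ} {L : Type*} [Field L]

/-- **Schmidt's system (2.2).** For `φ` of degree `≤ e + 1` and `g = Σ b_κ X^κ` of degree `≤ e`:
the matrix of the linear system `c a_i = Σ_{j + k = i} b_j c_k` (`|i| ≤ 2e`) in the unknowns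
`(c, c_k)` kills a non-zero vector iff `c φ = g h` for some `(c, h) ≠ 0` with `deg h ≤ e`
("If `g` divides `f`, then (2.2) has a solution with `c = 1` … Conversely …").
[cite: Schmidt1976, Ch. V Thm. 2A (proof, (2.2))] -/
theorem system22_iff {e : ℕ} (he : 1 ≤ e) (φ : MvPolynomial (Fin N) L)
    (hφ : φ.totalDegree ≤ e + 1) (b : ↥((Finset.range (e + 1)).biUnion fun i => (Finset.univ : Finset (Fin N)).finsuppAntidiag i) → L) :
    (∃ w : Unit ⊕ ↥((Finset.range (e + 1)).biUnion fun i => (Finset.univ : Finset (Fin N)).finsuppAntidiag i) → L, w ≠ 0 ∧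
      (Matrix.of fun (i : ↥((Finset.range (2 * e + 1)).biUnion fun i => (Finset.univ : Finset (Fin N)).finsuppAntidiag i)) (c : Unit ⊕ ↥((Finset.range (e + 1)).biUnion fun i => (Finset.univ : Finset (Fin N)).finsuppAntidiag i)) =>
        Sum.elim (fun _ => (fun m => coeff m φ) i.1)
          (fun κ => -∑ κ' : ↥((Finset.range (e + 1)).biUnion fun i => (Finset.univ : Finset (Fin N)).finsuppAntidiag i), if κ.1 + κ'.1 = i.1 then b κ' else 0) c).mulVec w = 0) ↔
    ∃ (h : MvPolynomial (Fin N) L) (c : L), (c ≠ 0 ∨ h ≠ 0) ∧ h.totalDegree ≤ e ∧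
      C c * φ = (∑ κ : ↥((Finset.range (e + 1)).biUnion fun i => (Finset.univ : Finset (Fin N)).finsuppAntidiag i), monomial κ.1 (b κ)) * h := by
  classical
  -- the key computation: the `i`-th entry of `M w` is the `X^i`-coefficient of `c φ - g h_w`
  have key : ∀ (w : Unit ⊕ ↥((Finset.range (e + 1)).biUnion fun i => (Finset.univ : Finset (Fin N)).finsuppAntidiag i) → L) (i : Fin N →₀ ℕ),
      coeff i (C (w (Sum.inl ())) * φ -
        (∑ κ : ↥((Finset.range (e + 1)).biUnion fun i => (Finset.univ : Finset (Fin N)).finsuppAntidiag i), monomial κ.1 (b κ)) *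
          ∑ κ : ↥((Finset.range (e + 1)).biUnion fun i => (Finset.univ : Finset (Fin N)).finsuppAntidiag i), monomial κ.1 (w (Sum.inr κ))) =
      coeff i φ * w (Sum.inl ()) +
        ∑ κ : ↥((Finset.range (e + 1)).biUnion fun i => (Finset.univ : Finset (Fin N)).finsuppAntidiag i),
          (-∑ κ' : ↥((Finset.range (e + 1)).biUnion fun i => (Finset.univ : Finset (Fin N)).finsuppAntidiag i), if κ.1 + κ'.1 = i then b κ' else 0) * w (Sum.inr κ) := by
    intro w i
    rw [coeff_sub, coeff_C_mul, Finset.sum_mul_sum, coeff_sum]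
    simp only [monomial_mul, coeff_sum, coeff_monomial, neg_mul, Finset.sum_neg_distrib,
      Finset.sum_mul, ite_mul, zero_mul]
    rw [Finset.sum_comm]
    simp only [add_comm (_ : Fin N →₀ ℕ), mul_comm (b _)]
    ring
  have hmul : ∀ (w : Unit ⊕ ↥((Finset.range (e + 1)).biUnion fun i => (Finset.univ : Finset (Fin N)).finsuppAntidiag i) → L) (i : ↥((Finset.range (2 * e + 1)).biUnion fun i => (Finset.univ : Finset (Fin N)).finsuppAntidiag i)),
      (Matrix.of fun (i : ↥((Finset.range (2 * e + 1)).biUnion fun i => (Finset.univ : Finset (Fin N)).finsuppAntidiag i)) (c : Unit ⊕ ↥((Finset.range (e + 1)).biUnion fun i => (Finset.univ : Finset (Fin N)).finsuppAntidiag i)) =>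
        Sum.elim (fun _ => (fun m => coeff m φ) i.1)
          (fun κ => -∑ κ' : ↥((Finset.range (e + 1)).biUnion fun i => (Finset.univ : Finset (Fin N)).finsuppAntidiag i), if κ.1 + κ'.1 = i.1 then b κ' else 0) c).mulVec w i =
      coeff i.1 φ * w (Sum.inl ()) +
        ∑ κ : ↥((Finset.range (e + 1)).biUnion fun i => (Finset.univ : Finset (Fin N)).finsuppAntidiag i),
          (-∑ κ' : ↥((Finset.range (e + 1)).biUnion fun i => (Finset.univ : Finset (Fin N)).finsuppAntidiag i), if κ.1 + κ'.1 = i.1 then b κ' else 0) * w (Sum.inr κ) := by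
    intro w i
    rw [Matrix.mulVec, dotProduct, Fintype.sum_sum_type]
    simp
  -- degrees
  have hdeg : ∀ (w : Unit ⊕ ↥((Finset.range (e + 1)).biUnion fun i => (Finset.univ : Finset (Fin N)).finsuppAntidiag i) → L),
      (C (w (Sum.inl ())) * φ -
        (∑ κ : ↥((Finset.range (e + 1)).biUnion fun i => (Finset.univ : Finset (Fin N)).finsuppAntidiag i), monomial κ.1 (b κ)) *
          ∑ κ : ↥((Finset.range (e + 1)).biUnion fun i => (Finset.univ : Finset (Fin N)).finsuppAntidiag i), monomial κ.1 (w (Sum.inr κ))).totalDegree ≤ 2 * e := by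
    intro w
    refine (totalDegree_sub _ _).trans (max_le ?_ ?_)
    · refine (totalDegree_mul _ _).trans ?_
      rw [totalDegree_C, zero_add]
      omega
    · refine (totalDegree_mul _ _).trans ?_
      have h1 := totalDegree_sum_monomial_subtype_le (N := N) b
      have h2 := totalDegree_sum_monomial_subtype_le (N := N) fun κ => w (Sum.inr κ)
      omega
  have hsys : ∀ (w : Unit ⊕ ↥((Finset.range (e + 1)).biUnion fun i => (Finset.univ : Finset (Fin N)).finsuppAntidiag i) → L),
      (Matrix.of fun (i : ↥((Finset.range (2 * e + 1)).biUnion fun i => (Finset.univ : Finset (Fin N)).finsuppAntidiag i)) (c : Unit ⊕ ↥((Finset.range (e + 1)).biUnion fun i => (Finset.univ : Finset (Fin N)).finsuppAntidiag i)) =>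
        Sum.elim (fun _ => (fun m => coeff m φ) i.1)
          (fun κ => -∑ κ' : ↥((Finset.range (e + 1)).biUnion fun i => (Finset.univ : Finset (Fin N)).finsuppAntidiag i), if κ.1 + κ'.1 = i.1 then b κ' else 0) c).mulVec w = 0 ↔
      C (w (Sum.inl ())) * φ =
        (∑ κ : ↥((Finset.range (e + 1)).biUnion fun i => (Finset.univ : Finset (Fin N)).finsuppAntidiag i), monomial κ.1 (b κ)) * ∑ κ : ↥((Finset.range (e + 1)).biUnion fun i => (Finset.univ : Finset (Fin N)).finsuppAntidiag i), monomial κ.1 (w (Sum.inr κ)) := by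
    intro w
    rw [← sub_eq_zero (b := _ * _)]
    constructor
    · intro h
      ext i
      rw [coeff_zero]
      by_cases hi : i ∈ ((Finset.range (2 * e + 1)).biUnion fun i => (Finset.univ : Finset (Fin N)).finsuppAntidiag i)
      · have := congr_fun h ⟨i, hi⟩
        rw [hmul] at this
        rw [key]
        exact this
      · rw [mem_monomialsLE, not_le] at hi
        by_contra hne
        have h1 := le_totalDegree (mem_support_iff.mpr hne)
        have h2 : (i.sum fun _ e => e) = i.degree := by rw [Finsupp.degree_apply, Finsupp.sum]
        have h3 := hdeg w
        omega
    · intro h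
      funext i
      rw [hmul, Pi.zero_apply, ← key, h, coeff_zero]
  constructor
  · rintro ⟨w, hw, hMw⟩
    refine ⟨∑ κ : ↥((Finset.range (e + 1)).biUnion fun i => (Finset.univ : Finset (Fin N)).finsuppAntidiag i), monomial κ.1 (w (Sum.inr κ)), w (Sum.inl ()), ?_,
      totalDegree_sum_monomial_subtype_le _, (hsys w).mp hMw⟩
    by_contra hboth
    push Not at hboth
    apply hw
    funext c
    rcases c with u | κ
    · exact hboth.1
    · have := (sum_monomial_subtype_eq_zero_iff _).mp hboth.2
      exact congr_fun this κ
  · rintro ⟨h, c, hch, hhdeg, hEq⟩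
    refine ⟨Sum.elim (fun _ => c) (fun κ => coeff κ.1 h), ?_, ?_⟩
    · intro hw
      rcases hch with hc | hh
      · exact hc (by simpa using congr_fun hw (Sum.inl ()))
      · apply hh
        rw [eq_sum_monomial_of_totalDegree_le h hhdeg, sum_monomial_subtype_eq_zero_iff]
        funext κ
        simpa using congr_fun hw (Sum.inr κ)
    · rw [hsys]
      simp only [Sum.elim_inl, Sum.elim_inr]
      rw [← eq_sum_monomial_of_totalDegree_le h hhdeg]
      exact hEq

/-- Schmidt's reformulation of "reducible or of degree `< d`" (`d = e + 1`) through the system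
(2.2): `∃ g ≠ 0, (c, h) ≠ 0` of degrees `≤ e` with `c φ = g h` iff for some `b ≠ 0` the matrix of
(2.2) kills a non-zero vector. [cite: Schmidt1976, Ch. V Thm. 2A (proof)] -/
theorem redOrDegLt_iff_system22 {e : ℕ} (he : 1 ≤ e) (φ : MvPolynomial (Fin N) L)
    (hφ : φ.totalDegree ≤ e + 1) :
    (∃ (g h : MvPolynomial (Fin N) L) (c : L), g ≠ 0 ∧ (c ≠ 0 ∨ h ≠ 0) ∧
      g.totalDegree ≤ e ∧ h.totalDegree ≤ e ∧ C c * φ = g * h) ↔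
    ∃ b : ↥((Finset.range (e + 1)).biUnion fun i => (Finset.univ : Finset (Fin N)).finsuppAntidiag i) → L, b ≠ 0 ∧ ∃ w : Unit ⊕ ↥((Finset.range (e + 1)).biUnion fun i => (Finset.univ : Finset (Fin N)).finsuppAntidiag i) → L, w ≠ 0 ∧
      (Matrix.of fun (i : ↥((Finset.range (2 * e + 1)).biUnion fun i => (Finset.univ : Finset (Fin N)).finsuppAntidiag i)) (c : Unit ⊕ ↥((Finset.range (e + 1)).biUnion fun i => (Finset.univ : Finset (Fin N)).finsuppAntidiag i)) =>
        Sum.elim (fun _ => (fun m => coeff m φ) i.1)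
          (fun κ => -∑ κ' : ↥((Finset.range (e + 1)).biUnion fun i => (Finset.univ : Finset (Fin N)).finsuppAntidiag i), if κ.1 + κ'.1 = i.1 then b κ' else 0) c).mulVec w = 0 := by
  constructor
  · rintro ⟨g, h, c, hg, hch, hgdeg, hhdeg, hEq⟩
    refine ⟨fun κ => coeff κ.1 g, ?_, ?_⟩
    · intro hb
      apply hg
      rw [eq_sum_monomial_of_totalDegree_le g hgdeg, sum_monomial_subtype_eq_zero_iff]
      exact hb
    · rw [system22_iff he φ hφ]
      refine ⟨h, c, hch, hhdeg, ?_⟩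
      rw [← eq_sum_monomial_of_totalDegree_le g hgdeg]
      exact hEq
  · rintro ⟨b, hb, hw⟩
    rw [system22_iff he φ hφ] at hw
    obtain ⟨h, c, hch, hhdeg, hEq⟩ := hw
    refine ⟨_, h, c, ?_, hch, totalDegree_sum_monomial_subtype_le _, hhdeg, hEq⟩
    rw [Ne, sum_monomial_subtype_eq_zero_iff]
    exact hb

end System


/-! ### The minors `Δ` as integer forms -/

section Minors

variable {N : ℕ} (e : ℕ)

/-- Each `(k+1) × (k+1)` minor `Δ` of the system (2.2), as a polynomial in the coefficient
variables `A` (all exponent vectors) and `B` (exponent vectors of degree `≤ e`), is linear in `A`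
and a form of degree `k` in `B` ("each `Δᵢ` is a form in the coefficients `b` … of degree `k`").
[cite: Schmidt1976, Ch. V Thm. 2A (proof)] -/
theorem noetherMinor_isWeightedHomogeneous (ρ : Unit ⊕ ↥((Finset.range (e + 1)).biUnion fun i => (Finset.univ : Finset (Fin N)).finsuppAntidiag i) → ↥((Finset.range (2 * e + 1)).biUnion fun i => (Finset.univ : Finset (Fin N)).finsuppAntidiag i)) :
    IsWeightedHomogeneous (Sum.elim (fun _ : Fin N →₀ ℕ => ((1 : ℕ), (0 : ℕ))) (fun _ : ↥((Finset.range (e + 1)).biUnion fun i => (Finset.univ : Finset (Fin N)).finsuppAntidiag i) => ((0 : ℕ), (1 : ℕ))))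
      ((Matrix.of fun (i : ↥((Finset.range (2 * e + 1)).biUnion fun i => (Finset.univ : Finset (Fin N)).finsuppAntidiag i)) (c : Unit ⊕ ↥((Finset.range (e + 1)).biUnion fun i => (Finset.univ : Finset (Fin N)).finsuppAntidiag i)) =>
        Sum.elim (fun _ => (X (Sum.inl i.1) : MvPolynomial ((Fin N →₀ ℕ) ⊕ ↥((Finset.range (e + 1)).biUnion fun i => (Finset.univ : Finset (Fin N)).finsuppAntidiag i)) ℤ))
          (fun κ => -∑ κ' : ↥((Finset.range (e + 1)).biUnion fun i => (Finset.univ : Finset (Fin N)).finsuppAntidiag i),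
            if κ.1 + κ'.1 = i.1 then (X (Sum.inr κ') : MvPolynomial ((Fin N →₀ ℕ) ⊕ ↥((Finset.range (e + 1)).biUnion fun i => (Finset.univ : Finset (Fin N)).finsuppAntidiag i)) ℤ) else 0) c).submatrix ρ id).det
      ((1 : ℕ), Fintype.card ↥((Finset.range (e + 1)).biUnion fun i => (Finset.univ : Finset (Fin N)).finsuppAntidiag i)) := by
  classical
  refine det_isWeightedHomogeneous _ _
    (fun _ c => Sum.elim (fun _ => ((1 : ℕ), (0 : ℕ))) (fun _ => ((0 : ℕ), (1 : ℕ))) c) _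
    (fun c c' => ?_) (fun π => ?_)
  · rcases c' with u | κ
    · simp only [Matrix.submatrix_apply, id_eq, Matrix.of_apply, Sum.elim_inl]
      exact isWeightedHomogeneous_X ℤ _ _
    · simp only [Matrix.submatrix_apply, id_eq, Matrix.of_apply, Sum.elim_inr]
      refine (weightedHomogeneousSubmodule ℤ _ _).neg_mem
        (IsWeightedHomogeneous.sum _ _ _ fun κ' _ => ?_)
      split_ifs
      · exact isWeightedHomogeneous_X ℤ _ _
      · exact isWeightedHomogeneous_zero ℤ _ _
  · rw [Fintype.sum_sum_type]
    simp only [Sum.elim_inl, Sum.elim_inr, Finset.sum_const, Finset.card_univ, Prod.smul_mk,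
      smul_eq_mul, mul_zero, mul_one, Fintype.card_unit, Prod.mk_add_mk, add_zero, zero_add]

/-- The entries of the matrix of (2.2) have norm `≤ 1` (each row meets each `b_j` at most once).
[folklore] -/
theorem l1Norm_noetherMatrix_entry_le (i : ↥((Finset.range (2 * e + 1)).biUnion fun i => (Finset.univ : Finset (Fin N)).finsuppAntidiag i)) (c : Unit ⊕ ↥((Finset.range (e + 1)).biUnion fun i => (Finset.univ : Finset (Fin N)).finsuppAntidiag i)) :
    l1Norm ((Matrix.of fun (i : ↥((Finset.range (2 * e + 1)).biUnion fun i => (Finset.univ : Finset (Fin N)).finsuppAntidiag i)) (c : Unit ⊕ ↥((Finset.range (e + 1)).biUnion fun i => (Finset.univ : Finset (Fin N)).finsuppAntidiag i)) =>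
        Sum.elim (fun _ => (X (Sum.inl i.1) : MvPolynomial ((Fin N →₀ ℕ) ⊕ ↥((Finset.range (e + 1)).biUnion fun i => (Finset.univ : Finset (Fin N)).finsuppAntidiag i)) ℤ))
          (fun κ => -∑ κ' : ↥((Finset.range (e + 1)).biUnion fun i => (Finset.univ : Finset (Fin N)).finsuppAntidiag i),
            if κ.1 + κ'.1 = i.1 then (X (Sum.inr κ') : MvPolynomial ((Fin N →₀ ℕ) ⊕ ↥((Finset.range (e + 1)).biUnion fun i => (Finset.univ : Finset (Fin N)).finsuppAntidiag i)) ℤ) else 0) c) i c) ≤ 1 := by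
  classical
  rcases c with u | κ
  · simp
  · simp only [Matrix.of_apply, Sum.elim_inr, l1Norm_neg]
    rw [← Finset.sum_filter]
    have hcard : ((Finset.univ : Finset ↥((Finset.range (e + 1)).biUnion fun i => (Finset.univ : Finset (Fin N)).finsuppAntidiag i)).filter fun κ' => κ.1 + κ'.1 = i.1).card ≤ 1 := by
      refine Finset.card_le_one.mpr fun x hx y hy => ?_
      rw [Finset.mem_filter] at hx hy
      exact Subtype.ext (add_left_cancel (hx.2.trans hy.2.symm))
    refine (l1Norm_sum_le _ _).trans ?_
    simpa using hcard

/-- `‖Δ‖ ≤ (k+1)!` for each minor (Schmidt: the coefficients have "norm at most `k!`"; the cruder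
factorial suffices). [cite: Schmidt1976, Ch. V Thm. 2A (proof)] -/
theorem l1Norm_noetherMinor_le (ρ : Unit ⊕ ↥((Finset.range (e + 1)).biUnion fun i => (Finset.univ : Finset (Fin N)).finsuppAntidiag i) → ↥((Finset.range (2 * e + 1)).biUnion fun i => (Finset.univ : Finset (Fin N)).finsuppAntidiag i)) :
    l1Norm ((Matrix.of fun (i : ↥((Finset.range (2 * e + 1)).biUnion fun i => (Finset.univ : Finset (Fin N)).finsuppAntidiag i)) (c : Unit ⊕ ↥((Finset.range (e + 1)).biUnion fun i => (Finset.univ : Finset (Fin N)).finsuppAntidiag i)) =>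
        Sum.elim (fun _ => (X (Sum.inl i.1) : MvPolynomial ((Fin N →₀ ℕ) ⊕ ↥((Finset.range (e + 1)).biUnion fun i => (Finset.univ : Finset (Fin N)).finsuppAntidiag i)) ℤ))
          (fun κ => -∑ κ' : ↥((Finset.range (e + 1)).biUnion fun i => (Finset.univ : Finset (Fin N)).finsuppAntidiag i),
            if κ.1 + κ'.1 = i.1 then (X (Sum.inr κ') : MvPolynomial ((Fin N →₀ ℕ) ⊕ ↥((Finset.range (e + 1)).biUnion fun i => (Finset.univ : Finset (Fin N)).finsuppAntidiag i)) ℤ) else 0) c).submatrix ρ id).det ≤ (Fintype.card ↥((Finset.range (e + 1)).biUnion fun i => (Finset.univ : Finset (Fin N)).finsuppAntidiag i) + 1).factorial := by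
  classical
  refine (l1Norm_det_le_factorial _ fun c c' => ?_).trans ?_
  · rw [Matrix.submatrix_apply]
    exact l1Norm_noetherMatrix_entry_le e _ _
  · rw [Fintype.card_sum, Fintype.card_unit, add_comm]

/-- Specialising `A ↦ a`, `B ↦ b` in a minor gives the corresponding minor of the matrix of (2.2)
with coefficients `a, b`. [folklore] -/
theorem aeval_noetherMinor {L : Type*} [CommRing L] (a : (Fin N →₀ ℕ) → L) (b : ↥((Finset.range (e + 1)).biUnion fun i => (Finset.univ : Finset (Fin N)).finsuppAntidiag i) → L)
    (ρ : Unit ⊕ ↥((Finset.range (e + 1)).biUnion fun i => (Finset.univ : Finset (Fin N)).finsuppAntidiag i) → ↥((Finset.range (2 * e + 1)).biUnion fun i => (Finset.univ : Finset (Fin N)).finsuppAntidiag i)) :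
    aeval (Sum.elim a b) ((Matrix.of fun (i : ↥((Finset.range (2 * e + 1)).biUnion fun i => (Finset.univ : Finset (Fin N)).finsuppAntidiag i)) (c : Unit ⊕ ↥((Finset.range (e + 1)).biUnion fun i => (Finset.univ : Finset (Fin N)).finsuppAntidiag i)) =>
        Sum.elim (fun _ => (X (Sum.inl i.1) : MvPolynomial ((Fin N →₀ ℕ) ⊕ ↥((Finset.range (e + 1)).biUnion fun i => (Finset.univ : Finset (Fin N)).finsuppAntidiag i)) ℤ))
          (fun κ => -∑ κ' : ↥((Finset.range (e + 1)).biUnion fun i => (Finset.univ : Finset (Fin N)).finsuppAntidiag i),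
            if κ.1 + κ'.1 = i.1 then (X (Sum.inr κ') : MvPolynomial ((Fin N →₀ ℕ) ⊕ ↥((Finset.range (e + 1)).biUnion fun i => (Finset.univ : Finset (Fin N)).finsuppAntidiag i)) ℤ) else 0) c).submatrix ρ id).det =
      ((Matrix.of fun (i : ↥((Finset.range (2 * e + 1)).biUnion fun i => (Finset.univ : Finset (Fin N)).finsuppAntidiag i)) (c : Unit ⊕ ↥((Finset.range (e + 1)).biUnion fun i => (Finset.univ : Finset (Fin N)).finsuppAntidiag i)) =>
        Sum.elim (fun _ => a i.1)
          (fun κ => -∑ κ' : ↥((Finset.range (e + 1)).biUnion fun i => (Finset.univ : Finset (Fin N)).finsuppAntidiag i), if κ.1 + κ'.1 = i.1 then b κ' else 0) c).submatrix ρ id).det := by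
  rw [AlgHom.map_det]
  congr 1
  ext c c'
  rcases c' with u | κ
  · simp [Matrix.submatrix_apply]
  · simp [Matrix.submatrix_apply, apply_ite (aeval (Sum.elim a b))]

end Minors


/-! ### Theorem 1A/1D for an arbitrary finite set of variables -/

section Transport

/-- Transport of the sums `Σ_{|m| = d} a_{j,m} x^m` along a bijection of the variables. [folklore] -/
theorem sum_finsuppAntidiag_equiv {τ : Type} [Fintype τ] [DecidableEq τ] {n : ℕ} (e : τ ≃ Fin (n + 1))
    {L : Type*} [CommSemiring L] (d : ℕ) (f : (τ →₀ ℕ) → L) (y : τ → L) :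
    ∑ m₀ ∈ (Finset.univ : Finset (Fin (n + 1))).finsuppAntidiag d,
        f (Finsupp.equivMapDomain e.symm m₀) * ∏ i, y (e.symm i) ^ m₀ i =
      ∑ m ∈ (Finset.univ : Finset τ).finsuppAntidiag d, f m * ∏ t, y t ^ m t := by
  refine Finset.sum_equiv (Finsupp.equivCongrLeft e.symm) (fun m₀ => ?_) (fun m₀ _ => ?_)
  · rw [Finsupp.equivCongrLeft_apply]
    constructor
    · intro h
      refine mem_finsuppAntidiag_of_degree_eq ?_
      rw [← degree_eq_of_mem_finsuppAntidiag h, Finsupp.degree_eq_sum, Finsupp.degree_eq_sum,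
        ← Fintype.sum_equiv e.symm _ _ (fun i => rfl)]
      simp [Finsupp.equivMapDomain_apply]
    · intro h
      refine mem_finsuppAntidiag_of_degree_eq ?_
      rw [← degree_eq_of_mem_finsuppAntidiag h, Finsupp.degree_eq_sum, Finsupp.degree_eq_sum,
        ← Fintype.sum_equiv e.symm _ _ (fun i => rfl)]
      simp [Finsupp.equivMapDomain_apply]
  · rw [Finsupp.equivCongrLeft_apply]
    congr 1
    rw [← Fintype.prod_equiv e.symm _ _ (fun i => rfl)]
    simp [Finsupp.equivMapDomain_apply]

/-- **Theorems 1A + 1D** for forms in an arbitrary finite non-empty set `τ` of variables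
(transport of `elimination_main` along `τ ≃ Fin (n+1)`). [cite: Schmidt1976, Ch. V Thm. 1A, Thm. 1D] -/
theorem elimination_main_type (τ : Type) [Fintype τ] [DecidableEq τ] (n : ℕ)
    (hτ : Fintype.card τ = n + 1) (d : ℕ) (hd : 1 ≤ d) (J : Type) [Fintype J] [DecidableEq J] :
    ∃ S : Finset (MvPolynomial (J × (τ →₀ ℕ)) ℤ),
      (∀ g ∈ S, g.totalDegree ≤ 2 ^ n * d ^ (2 ^ n - 1) ∧
        l1Norm g ≤ 2 ^ ((2 * n + 3) * 2 ^ n * d ^ 2 ^ n)) ∧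
      ∀ (L : Type) [Field L] [IsAlgClosed L] (a : J × (τ →₀ ℕ) → L),
        (∃ x : τ → L, x ≠ 0 ∧ ∀ j : J,
            ∑ m ∈ (Finset.univ : Finset τ).finsuppAntidiag d, a (j, m) * ∏ t, x t ^ m t = 0) ↔
        ∀ g ∈ S, aeval a g = 0 := by
  classical
  obtain ⟨e⟩ : Nonempty (τ ≃ Fin (n + 1)) := Fintype.card_eq.mp (by rw [hτ, Fintype.card_fin])
  obtain ⟨S₀, hS₀, hiff₀⟩ := elimination_main n d hd J
  let ψ : J × (Fin (n + 1) →₀ ℕ) → J × (τ →₀ ℕ) := fun p => (p.1, Finsupp.equivMapDomain e.symm p.2)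
  refine ⟨S₀.image (rename ψ), ?_, ?_⟩
  · intro g hg
    obtain ⟨g₀, hg₀, rfl⟩ := Finset.mem_image.mp hg
    exact ⟨(totalDegree_rename_le _ _).trans (hS₀ g₀ hg₀).1,
      (l1Norm_rename_le _ _).trans (hS₀ g₀ hg₀).2⟩
  · intro L _ _ a
    rw [Finset.forall_mem_image]
    simp only [aeval_rename]
    rw [← hiff₀ L (a ∘ ψ)]
    constructor
    · rintro ⟨x, hx, h⟩
      refine ⟨x ∘ e.symm, fun h0 => hx ?_, fun j => ?_⟩
      · funext t
        have := congr_fun h0 (e t)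
        simpa using this
      · rw [← h j]
        exact sum_finsuppAntidiag_equiv e d (fun m => a (j, m)) x
    · rintro ⟨x₀, hx₀, h⟩
      refine ⟨x₀ ∘ e, fun h0 => hx₀ ?_, fun j => ?_⟩
      · funext i
        have := congr_fun h0 (e.symm i)
        simpa using this
      · rw [← h j, ← sum_finsuppAntidiag_equiv e d (fun m => a (j, m)) (x₀ ∘ e)]
        simp [ψ]

end Transport


/-! ### Theorem 2A -/

section Noether

/-- **Theorem 2A (E. Noether 1922), with Schmidt's bounds in recursive form.** `N ≥ 1` variables,
`d = e + 1 ≥ 2`, `k = C(N + e, N)`. There is a finite set `S` of integer polynomials in the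
coefficient variables `A_m` (`m` any exponent vector in `N` variables) with
`deg γ ≤ 2^{k-1} k^{2^{k-1}-1}` and `‖γ‖ ≤ 2^{(2k+1) 2^{k-1} k^{2^{k-1}}} ((k+1)!)^{2^{k-1} k^{2^{k-1}-1}}`
such that for every algebraically closed field `L` and every `φ ∈ L[X₁, …, X_N]` of degree `≤ d`:
`φ` "is reducible or of degree `< d`" in the precise sense of the system (2.2) —
`∃ g ≠ 0, (c, h) ≠ 0, deg g, deg h ≤ e, c φ = g h` — iff `γ(coeff φ) = 0` for all `γ ∈ S`.
(Schmidt: `deg ≤ k^{2^k}`, `‖·‖ ≤ 4^{k^{2^k}}`, which follow for `k ≥ 3`.) [cite: Schmidt1976, Ch. V Thm. 2A] -/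
theorem noether_forms_exist (N e : ℕ) (hN : 1 ≤ N) (he : 1 ≤ e) :
    ∃ S : Finset (MvPolynomial (Fin N →₀ ℕ) ℤ),
      (∀ γ ∈ S,
        γ.totalDegree ≤ 2 ^ ((N + e).choose N - 1) * (N + e).choose N ^ (2 ^ ((N + e).choose N - 1) - 1) ∧
        l1Norm γ ≤ 2 ^ ((2 * ((N + e).choose N - 1) + 3) * 2 ^ ((N + e).choose N - 1) *
            (N + e).choose N ^ 2 ^ ((N + e).choose N - 1)) *
          ((N + e).choose N + 1).factorial ^
            (2 ^ ((N + e).choose N - 1) * (N + e).choose N ^ (2 ^ ((N + e).choose N - 1) - 1))) ∧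
      ∀ (L : Type) [Field L] [IsAlgClosed L] (φ : MvPolynomial (Fin N) L),
        φ.totalDegree ≤ e + 1 →
        ((∃ (g h : MvPolynomial (Fin N) L) (c : L), g ≠ 0 ∧ (c ≠ 0 ∨ h ≠ 0) ∧
            g.totalDegree ≤ e ∧ h.totalDegree ≤ e ∧ C c * φ = g * h) ↔
          ∀ γ ∈ S, aeval (fun m => coeff m φ) γ = 0) := by
  classical
  have hk1 : 1 ≤ (N + e).choose N := Nat.choose_pos (by omega)
  have hcardτ : Fintype.card ↥((Finset.range (e + 1)).biUnion fun i => (Finset.univ : Finset (Fin N)).finsuppAntidiag i) = ((N + e).choose N - 1) + 1 := by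
    rw [Fintype.card_coe, card_monomialsLE hN, Nat.sub_add_cancel hk1]
  obtain ⟨S₁, hS₁, hiff₁⟩ := elimination_main_type ↥((Finset.range (e + 1)).biUnion fun i => (Finset.univ : Finset (Fin N)).finsuppAntidiag i) ((N + e).choose N - 1) hcardτ
    ((N + e).choose N) hk1 (Unit ⊕ ↥((Finset.range (e + 1)).biUnion fun i => (Finset.univ : Finset (Fin N)).finsuppAntidiag i) → ↥((Finset.range (2 * e + 1)).biUnion fun i => (Finset.univ : Finset (Fin N)).finsuppAntidiag i))
  -- the coefficient polynomials (in the `A`'s) of the minors `Δ_ρ` as forms in the `B`'s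
  set cf : (Unit ⊕ ↥((Finset.range (e + 1)).biUnion fun i => (Finset.univ : Finset (Fin N)).finsuppAntidiag i) → ↥((Finset.range (2 * e + 1)).biUnion fun i => (Finset.univ : Finset (Fin N)).finsuppAntidiag i)) × (↥((Finset.range (e + 1)).biUnion fun i => (Finset.univ : Finset (Fin N)).finsuppAntidiag i) →₀ ℕ) → MvPolynomial (Fin N →₀ ℕ) ℤ :=
    fun p => ∑ w ∈ ((((Matrix.of fun (i : ↥((Finset.range (2 * e + 1)).biUnion fun i => (Finset.univ : Finset (Fin N)).finsuppAntidiag i)) (c : Unit ⊕ ↥((Finset.range (e + 1)).biUnion fun i => (Finset.univ : Finset (Fin N)).finsuppAntidiag i)) =>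
        Sum.elim (fun _ => (X (Sum.inl i.1) : MvPolynomial ((Fin N →₀ ℕ) ⊕ ↥((Finset.range (e + 1)).biUnion fun i => (Finset.univ : Finset (Fin N)).finsuppAntidiag i)) ℤ))
          (fun κ => -∑ κ' : ↥((Finset.range (e + 1)).biUnion fun i => (Finset.univ : Finset (Fin N)).finsuppAntidiag i),
            if κ.1 + κ'.1 = i.1 then (X (Sum.inr κ') : MvPolynomial ((Fin N →₀ ℕ) ⊕ ↥((Finset.range (e + 1)).biUnion fun i => (Finset.univ : Finset (Fin N)).finsuppAntidiag i)) ℤ) else 0) c)).submatrix p.1 id).det).support with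
        (Finsupp.comapDomain Sum.inr w Sum.inr_injective.injOn) = p.2,
      monomial (Finsupp.comapDomain Sum.inl w Sum.inl_injective.injOn) (coeff w (((Matrix.of fun (i : ↥((Finset.range (2 * e + 1)).biUnion fun i => (Finset.univ : Finset (Fin N)).finsuppAntidiag i)) (c : Unit ⊕ ↥((Finset.range (e + 1)).biUnion fun i => (Finset.univ : Finset (Fin N)).finsuppAntidiag i)) =>
        Sum.elim (fun _ => (X (Sum.inl i.1) : MvPolynomial ((Fin N →₀ ℕ) ⊕ ↥((Finset.range (e + 1)).biUnion fun i => (Finset.univ : Finset (Fin N)).finsuppAntidiag i)) ℤ))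
          (fun κ => -∑ κ' : ↥((Finset.range (e + 1)).biUnion fun i => (Finset.univ : Finset (Fin N)).finsuppAntidiag i),
            if κ.1 + κ'.1 = i.1 then (X (Sum.inr κ') : MvPolynomial ((Fin N →₀ ℕ) ⊕ ↥((Finset.range (e + 1)).biUnion fun i => (Finset.univ : Finset (Fin N)).finsuppAntidiag i)) ℤ) else 0) c)).submatrix p.1 id).det) with hcf
  have hwdeg : ∀ (ρ : Unit ⊕ ↥((Finset.range (e + 1)).biUnion fun i => (Finset.univ : Finset (Fin N)).finsuppAntidiag i) → ↥((Finset.range (2 * e + 1)).biUnion fun i => (Finset.univ : Finset (Fin N)).finsuppAntidiag i)), ∀ w ∈ ((((Matrix.of fun (i : ↥((Finset.range (2 * e + 1)).biUnion fun i => (Finset.univ : Finset (Fin N)).finsuppAntidiag i)) (c : Unit ⊕ ↥((Finset.range (e + 1)).biUnion fun i => (Finset.univ : Finset (Fin N)).finsuppAntidiag i)) =>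
        Sum.elim (fun _ => (X (Sum.inl i.1) : MvPolynomial ((Fin N →₀ ℕ) ⊕ ↥((Finset.range (e + 1)).biUnion fun i => (Finset.univ : Finset (Fin N)).finsuppAntidiag i)) ℤ))
          (fun κ => -∑ κ' : ↥((Finset.range (e + 1)).biUnion fun i => (Finset.univ : Finset (Fin N)).finsuppAntidiag i),
            if κ.1 + κ'.1 = i.1 then (X (Sum.inr κ') : MvPolynomial ((Fin N →₀ ℕ) ⊕ ↥((Finset.range (e + 1)).biUnion fun i => (Finset.univ : Finset (Fin N)).finsuppAntidiag i)) ℤ) else 0) c)).submatrix ρ id).det).support,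
      (Finsupp.comapDomain Sum.inl w Sum.inl_injective.injOn).degree = 1 ∧ (Finsupp.comapDomain Sum.inr w Sum.inr_injective.injOn).degree = (N + e).choose N := by
    intro ρ w hw
    have h := noetherMinor_isWeightedHomogeneous e ρ (mem_support_iff.mp hw)
    rw [weight_gradingAB, Fintype.card_coe, card_monomialsLE hN] at h
    simp only [Prod.mk.injEq] at h
    exact h
  have hcfdeg : ∀ p, (cf p).totalDegree ≤ 1 := fun p =>
    totalDegree_sliceB_le _ _ 1 fun w hw => (hwdeg p.1 w hw).1.le
  have hcfnorm : ∀ p, l1Norm (cf p) ≤ ((N + e).choose N + 1).factorial := fun p =>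
    (l1Norm_sliceB_le _ _).trans ((l1Norm_noetherMinor_le e p.1).trans
      (by rw [Fintype.card_coe, card_monomialsLE hN]))
  refine ⟨S₁.image fun g₁ => bind₁ cf g₁, ?_, ?_⟩
  · intro γ hγ
    obtain ⟨g₁, hg₁, rfl⟩ := Finset.mem_image.mp hγ
    obtain ⟨hdeg₁, hnorm₁⟩ := hS₁ g₁ hg₁
    constructor
    · calc (bind₁ cf g₁).totalDegree ≤ g₁.totalDegree * 1 := totalDegree_bind₁_le cf 1 hcfdeg g₁
        _ ≤ _ := by rw [mul_one]; exact hdeg₁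
    · calc l1Norm (bind₁ cf g₁)
          ≤ l1Norm g₁ * ((N + e).choose N + 1).factorial ^
              (2 ^ ((N + e).choose N - 1) * (N + e).choose N ^ (2 ^ ((N + e).choose N - 1) - 1)) :=
            l1Norm_bind₁_le cf _ (Nat.factorial_pos _) hcfnorm g₁ _ hdeg₁
        _ ≤ _ := Nat.mul_le_mul_right _ hnorm₁
  · intro L _ _ φ hφ
    rw [Finset.forall_mem_image]
    simp only [aeval_bind₁]
    rw [← hiff₁ L (fun p => aeval (fun m => coeff m φ) (cf p)),
      redOrDegLt_iff_system22 he φ hφ]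
    refine exists_congr fun b => and_congr_right fun _ => ?_
    rw [exists_mulVec_eq_zero_iff_forall_det_submatrix]
    refine forall_congr' fun ρ => ?_
    rw [← aeval_noetherMinor e (fun m => coeff m φ) b ρ,
      aeval_eq_sum_sliceB _ (fun m => coeff m φ) b ((N + e).choose N) (fun w hw => (hwdeg ρ w hw).2)]

end Noether

end Literature.RingTheory.MvPolynomial

/-!
## Part 2. Ostrowski's theorem on the reduction of absolutely irreducible polynomials (Cor. 2B)

This file discharges the named fact
`Literature.RingTheory.MvPolynomial.ostrowski1919_absIrreducible_reduction`
(`AbsoluteIrreducibilityReduction.lean`): **Schmidt, *Equations over finite fields*, Ch. V,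
Corollary 2B (Ostrowski 1919)** — if `f ∈ ℤ[X₁, …, Xₙ]` has degree `d > 0` and is absolutely
irreducible, then for every prime `p > (4‖f‖)^{k^{2^k}}`, `k = C(n+d-1, n)`, the reduction of `f`
modulo `p` has degree `d` and is absolutely irreducible.

The proof is Schmidt's (p. 101 of the 2nd ed.): by Noether's Theorem 2A
(`noether_forms_exist`, Part 1) some integer form `g` of the resultant system does
not vanish at the coefficients of `f` (as `f` is absolutely irreducible of degree `d` over `ℚ`);
`0 < |g(a)| ≤ ‖g‖ ‖f‖^{deg g} ≤ (4‖f‖)^{k^{2^k}} < p`, so `g(a) ≢ 0 (mod p)`, and Theorem 2A over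
`𝔽̄_p` gives the absolute irreducibility of `f mod p`. The degenerate cases `d = 1` (a polynomial of
degree one is irreducible) and `n = 1` (an absolutely irreducible polynomial in one variable has
degree one) are treated directly, exactly as in Schmidt's proof of Thm. 2A ("We first dispose of
the trivial cases"); in the remaining case `k ≥ 3` and the recursive bounds of
`noether_forms_exist` are below Schmidt's `k^{2^k}` and `4^{k^{2^k}}`
(`noether_degree_le`, `noether_norm_le`).

Support files (all in this directory): `OstrowskiNorms` (Schmidt's norm), `OstrowskiResultant`
(resultants: isobaric property, norm), `OstrowskiElimination` (Lemma 1C, generic forms and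
specialisation, Thms. 1A, 1D); Thm. 2A is Part 1 of this file.

## References

* W. M. Schmidt, *Equations over finite fields. An elementary approach*, LNM 536 (1976),
  2nd ed. Kendrick Press (2004), Ch. V, Thm. 2A and Cor. 2B (pp. 99–101). [`Schmidt1976`]
* A. Ostrowski, *Zur arithmetischen Theorie der algebraischen Größen*, Göttinger Nachr. (1919)
  279–298.
-/

noncomputable section

open MvPolynomial

namespace Literature.RingTheory.MvPolynomial

open Literature.NumberTheory.DiophantineGeometry

/-! ### The numerical bounds of Theorem 2A: `deg ≤ k^{2^k}`, `‖·‖ ≤ 4^{k^{2^k}}` for `k ≥ 3` -/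

section Arith

/-- `j + 2 ≤ 2^j` for `j ≥ 2`. [folklore] -/
theorem add_two_le_two_pow {j : ℕ} (hj : 2 ≤ j) : j + 2 ≤ 2 ^ j := by
  induction j, hj using Nat.le_induction with
  | base => norm_num
  | succ j _ ih => rw [pow_succ]; omega

/-- Schmidt's degree estimate (2.3): `2^{k-1} k^{2^{k-1}-1} ≤ k^{2^k}` (here for `k ≥ 3`; Schmidt
states it for `k ≥ 2`). [cite: Schmidt1976, Ch. V Thm. 2A (proof, (2.3))] -/
theorem noether_degree_le {k : ℕ} (hk : 3 ≤ k) :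
    2 ^ (k - 1) * k ^ (2 ^ (k - 1) - 1) ≤ k ^ 2 ^ k := by
  have hk1 : 1 ≤ k := by omega
  have h1 : 2 ^ (k - 1) ≤ k ^ (k - 1) := Nat.pow_le_pow_left (by omega) _
  have h2 : k - 1 + (2 ^ (k - 1) - 1) ≤ 2 ^ k := by
    have := Nat.lt_two_pow_self (n := k - 1)
    have h2k : 2 ^ k = 2 * 2 ^ (k - 1) := by
      rw [← pow_succ']; congr 1; omega
    omega
  calc 2 ^ (k - 1) * k ^ (2 ^ (k - 1) - 1) ≤ k ^ (k - 1) * k ^ (2 ^ (k - 1) - 1) :=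
        Nat.mul_le_mul_right _ h1
    _ = k ^ (k - 1 + (2 ^ (k - 1) - 1)) := by rw [pow_add]
    _ ≤ k ^ 2 ^ k := Nat.pow_le_pow_right hk1 h2

/-- The key comparison behind Schmidt's norm estimate (2.4)ff for `k ≥ 3`:
`2^{k-1} (3k + 2) ≤ 2 k^{2^{k-1}}`. [cite: Schmidt1976, Ch. V Thm. 2A (proof, (2.4))] -/
theorem noether_norm_aux {k : ℕ} (hk : 3 ≤ k) :
    2 ^ (k - 1) * (3 * k + 2) ≤ 2 * k ^ 2 ^ (k - 1) := by
  obtain ⟨j, rfl⟩ : ∃ j, k = j + 1 := ⟨k - 1, by omega⟩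
  rw [Nat.add_sub_cancel]
  have hj : 2 ≤ j := by omega
  -- `2^{j+1} ≤ (j+1)^{2^j - 1}`
  have h1 : 2 ^ (j + 1) ≤ (j + 1) ^ (j + 1) := Nat.pow_le_pow_left (by omega) _
  have h2 : (j + 1) ^ (j + 1) ≤ (j + 1) ^ (2 ^ j - 1) :=
    Nat.pow_le_pow_right (by omega) (by have := add_two_le_two_pow hj; omega)
  have h3 : (j + 1) * (j + 1) ^ (2 ^ j - 1) = (j + 1) ^ 2 ^ j := by
    rw [← pow_succ']
    congr 1
    have := Nat.one_le_two_pow (n := j)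
    omega
  calc 2 ^ j * (3 * (j + 1) + 2) ≤ 2 ^ j * (4 * (j + 1)) := Nat.mul_le_mul_left _ (by omega)
    _ = 2 * ((j + 1) * 2 ^ (j + 1)) := by rw [pow_succ]; ring
    _ ≤ 2 * ((j + 1) * (j + 1) ^ (2 ^ j - 1)) :=
        Nat.mul_le_mul_left _ (Nat.mul_le_mul_left _ (h1.trans h2))
    _ = 2 * (j + 1) ^ 2 ^ j := by rw [h3]

/-- Schmidt's norm estimate for the forms of Thm. 2A, from the recursive bounds of Thms. 1A/1D and
the factor `((k+1)!)^{deg}` of the final substitution: for `k ≥ 3`,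
`2^{(2k+1) 2^{k-1} k^{2^{k-1}}} ((k+1)!)^{2^{k-1} k^{2^{k-1}-1}} ≤ 4^{k^{2^k}}`.
[cite: Schmidt1976, Ch. V Thm. 2A (proof, end)] -/
theorem noether_norm_le {k : ℕ} (hk : 3 ≤ k) :
    2 ^ ((2 * (k - 1) + 3) * 2 ^ (k - 1) * k ^ 2 ^ (k - 1)) *
        (k + 1).factorial ^ (2 ^ (k - 1) * k ^ (2 ^ (k - 1) - 1)) ≤ 4 ^ k ^ 2 ^ k := by
  have hk1 : 1 ≤ k := by omega
  -- abbreviations: `m = 2^{k-1}`, `P = k^{2^{k-1}-1}`, `k^{2^{k-1}} = k P`, `k^{2^k} = (k P)^2`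
  set m := 2 ^ (k - 1) with hm
  set P := k ^ (2 ^ (k - 1) - 1) with hP
  have hkm : k ^ 2 ^ (k - 1) = k * P := by
    rw [hP, ← pow_succ']
    congr 1
    have := Nat.one_le_two_pow (n := k - 1)
    omega
  have h2k : 2 ^ k = 2 * m := by
    rw [hm, ← pow_succ']
    congr 1
    omega
  have hkK : k ^ 2 ^ k = (k * P) * (k * P) := by
    rw [h2k, two_mul, pow_add, hkm]
  -- `(k+1)! ≤ 2^{k(k+1)}`
  have hfact : (k + 1).factorial ≤ 2 ^ (k * (k + 1)) := by
    calc (k + 1).factorial ≤ (k + 1) ^ (k + 1) := Nat.factorial_le_pow _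
      _ ≤ (2 ^ k) ^ (k + 1) := Nat.pow_le_pow_left Nat.lt_two_pow_self _
      _ = 2 ^ (k * (k + 1)) := by rw [← pow_mul]
  -- everything is a power of two
  have hX : (2 * (k - 1) + 3) * m * (k * P) + k * (k + 1) * (m * P) ≤ 2 * ((k * P) * (k * P)) := by
    have haux := noether_norm_aux hk
    rw [← hm, hkm] at haux
    have : (2 * (k - 1) + 3) * m * (k * P) + k * (k + 1) * (m * P) =
        (k * P) * (m * (3 * k + 2)) := by
      have : 2 * (k - 1) + 3 = 2 * k + 1 := by omega
      rw [this]
      ring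
    rw [this]
    calc k * P * (m * (3 * k + 2)) ≤ k * P * (2 * (k * P)) := Nat.mul_le_mul_left _ haux
      _ = 2 * (k * P * (k * P)) := by ring
  calc 2 ^ ((2 * (k - 1) + 3) * 2 ^ (k - 1) * k ^ 2 ^ (k - 1)) *
        (k + 1).factorial ^ (2 ^ (k - 1) * k ^ (2 ^ (k - 1) - 1))
        ≤ 2 ^ ((2 * (k - 1) + 3) * m * (k * P)) * (2 ^ (k * (k + 1))) ^ (m * P) := by
          rw [← hm, hkm, ← hP]
          exact Nat.mul_le_mul_left _ (Nat.pow_le_pow_left hfact _)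
    _ = 2 ^ ((2 * (k - 1) + 3) * m * (k * P) + k * (k + 1) * (m * P)) := by
          rw [← pow_mul, ← pow_add]
    _ ≤ 2 ^ (2 * ((k * P) * (k * P))) := Nat.pow_le_pow_right (by norm_num) hX
    _ = 4 ^ k ^ 2 ^ k := by rw [pow_mul, hkK]; norm_num

/-- `k = C(N+d-1, N) ≥ 3` as soon as `N ≥ 2` and `d ≥ 2` ("we may assume `d ≥ 2` and `n ≥ 2`,
from which it follows that `k ≥ 2`" — in fact `k ≥ 3`). [cite: Schmidt1976, Ch. V Thm. 2A (proof)] -/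
theorem three_le_choose {N d : ℕ} (hN : 2 ≤ N) (hd : 2 ≤ d) : 3 ≤ (N + d - 1).choose N := by
  calc 3 ≤ N + 1 := by omega
    _ = (N + 1).choose N := (Nat.choose_succ_self_right N).symm
    _ ≤ (N + d - 1).choose N := Nat.choose_le_choose N (by omega)

end Arith

/-! ### Degree bookkeeping -/

section Degree

variable {R : Type*} [CommSemiring R] {σ : Type*}

/-- A polynomial of degree `d` has a monomial of degree `d` in its support. [folklore] -/
theorem exists_mem_support_degree_eq {f : MvPolynomial σ R} (hf : f ≠ 0) :
    ∃ m ∈ f.support, m.degree = f.totalDegree := by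
  obtain ⟨m, hm, h⟩ := Finset.exists_mem_eq_sup f.support (support_nonempty.mpr hf)
    (fun s => s.sum fun _ e => e)
  exact ⟨m, hm, by rw [Finsupp.degree_apply, totalDegree, h, Finsupp.sum]⟩

end Degree

/-! ### Irreducibility versus Schmidt's factorisation condition -/

section Irreducible

variable {K : Type*} [Field K] {σ : Type*}

/-- Over a field, a unit of `K[X_σ]` has degree `0`. [folklore] -/
theorem totalDegree_eq_zero_of_isUnit {φ : MvPolynomial σ K} (h : IsUnit φ) : φ.totalDegree = 0 := by
  obtain ⟨u, rfl⟩ := h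
  have := totalDegree_mul_of_isDomain (f := (u : MvPolynomial σ K)) (g := (↑u⁻¹ : MvPolynomial σ K))
    u.ne_zero (u⁻¹).ne_zero
  rw [Units.mul_inv, totalDegree_one] at this
  omega

/-- Over a field, a non-zero polynomial of degree `0` is a unit. [folklore] -/
theorem isUnit_of_totalDegree_eq_zero {φ : MvPolynomial σ K} (h0 : φ ≠ 0) (h : φ.totalDegree = 0) :
    IsUnit φ := by
  rw [totalDegree_eq_zero_iff_eq_C] at h
  rw [h]
  refine (IsUnit.mk0 _ fun hc => h0 ?_).map C
  rw [h, hc, map_zero]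

/-- **A polynomial of degree one is (absolutely) irreducible** — the case `d = 1` of Thm. 2A ("if
`d = 1`, the forms may be taken to be just the variables"). [cite: Schmidt1976, Ch. V Thm. 2A (proof, d = 1)] -/
theorem irreducible_of_totalDegree_eq_one {φ : MvPolynomial σ K} (h : φ.totalDegree = 1) :
    Irreducible φ := by
  have h0 : φ ≠ 0 := fun h0 => by rw [h0, totalDegree_zero] at h; exact one_ne_zero h.symm
  refine ⟨fun hu => by have := totalDegree_eq_zero_of_isUnit hu; omega, fun a b hab => ?_⟩
  have ha : a ≠ 0 := fun ha => h0 (by rw [hab, ha, zero_mul])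
  have hb : b ≠ 0 := fun hb => h0 (by rw [hab, hb, mul_zero])
  have hdeg := totalDegree_mul_of_isDomain ha hb
  rw [← hab, h] at hdeg
  rcases Nat.eq_zero_or_pos a.totalDegree with ha0 | ha0
  · exact Or.inl (isUnit_of_totalDegree_eq_zero ha ha0)
  · exact Or.inr (isUnit_of_totalDegree_eq_zero hb (by omega))

/-- An irreducible polynomial of degree `e + 1` admits no relation `c φ = g h` with `g ≠ 0`,
`(c, h) ≠ 0`, `deg g, deg h ≤ e` ("Observe that `f` is reducible or `deg f < d` if and only if
`f = gh` with `deg g < d`, `deg h < d`", only-if direction). [cite: Schmidt1976, Ch. V Thm. 2A (proof)] -/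
theorem not_redOrDegLt_of_irreducible {e : ℕ} {φ : MvPolynomial σ K} (hirr : Irreducible φ)
    (hdeg : φ.totalDegree = e + 1) :
    ¬ ∃ (g h : MvPolynomial σ K) (c : K), g ≠ 0 ∧ (c ≠ 0 ∨ h ≠ 0) ∧
      g.totalDegree ≤ e ∧ h.totalDegree ≤ e ∧ C c * φ = g * h := by
  rintro ⟨g, h, c, hg, hch, hgdeg, hhdeg, hEq⟩
  by_cases hc : c = 0
  · subst hc
    rw [C_0, zero_mul] at hEq
    rcases mul_eq_zero.mp hEq.symm with h1 | h1
    · exact hg h1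
    · exact (hch.resolve_left (fun h => h rfl)) h1
  · have hφ : φ = (C c⁻¹ * g) * h := by
      rw [mul_assoc, ← hEq, ← mul_assoc, ← C_mul, inv_mul_cancel₀ hc, C_1, one_mul]
    have hg' : C c⁻¹ * g ≠ 0 := mul_ne_zero (by simp [hc]) hg
    have hh : h ≠ 0 := fun hh => by
      rw [hh, mul_zero] at hφ
      rw [hφ, totalDegree_zero] at hdeg
      omega
    have hsum := totalDegree_mul_of_isDomain hg' hh
    rw [← hφ, hdeg] at hsum
    have hg'deg : (C c⁻¹ * g).totalDegree ≤ e := (totalDegree_mul _ _).trans (by simpa using hgdeg)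
    rcases hirr.isUnit_or_isUnit hφ with hu | hu
    · have := totalDegree_eq_zero_of_isUnit hu; omega
    · have := totalDegree_eq_zero_of_isUnit hu; omega

/-- Conversely, a polynomial of degree `e + 1` admitting no such relation is irreducible
(if-direction of Schmidt's observation, with `c = 1`). [cite: Schmidt1976, Ch. V Thm. 2A (proof)] -/
theorem irreducible_of_not_redOrDegLt {e : ℕ} {φ : MvPolynomial σ K} (hdeg : φ.totalDegree = e + 1)
    (hno : ¬ ∃ (g h : MvPolynomial σ K) (c : K), g ≠ 0 ∧ (c ≠ 0 ∨ h ≠ 0) ∧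
      g.totalDegree ≤ e ∧ h.totalDegree ≤ e ∧ C c * φ = g * h) :
    Irreducible φ := by
  have h0 : φ ≠ 0 := fun h0 => by rw [h0, totalDegree_zero] at hdeg; omega
  refine ⟨fun hu => by have := totalDegree_eq_zero_of_isUnit hu; omega, fun a b hab => ?_⟩
  by_contra hnot
  push Not at hnot
  have ha : a ≠ 0 := fun ha => h0 (by rw [hab, ha, zero_mul])
  have hb : b ≠ 0 := fun hb => h0 (by rw [hab, hb, mul_zero])
  have ha1 : 1 ≤ a.totalDegree := by
    by_contra h1
    exact hnot.1 (isUnit_of_totalDegree_eq_zero ha (by omega))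
  have hb1 : 1 ≤ b.totalDegree := by
    by_contra h1
    exact hnot.2 (isUnit_of_totalDegree_eq_zero hb (by omega))
  have hsum := totalDegree_mul_of_isDomain ha hb
  rw [← hab, hdeg] at hsum
  exact hno ⟨a, b, 1, ha, Or.inl one_ne_zero, by omega, by omega, by rw [C_1, one_mul, hab]⟩

/-- **The case `n = 1` of Thm. 2A**: an absolutely irreducible polynomial in one variable has
degree `≤ 1` ("If `d ≥ 2` and `n = 1`, then `f` is always reducible over `K̄`").
[cite: Schmidt1976, Ch. V Thm. 2A (proof, n = 1)] -/
theorem totalDegree_le_one_of_irreducible_fin_one {L : Type*} [Field L] [IsAlgClosed L]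
    {φ : MvPolynomial (Fin 1) L} (hirr : Irreducible φ) : φ.totalDegree ≤ 1 := by
  -- pass to one-variable polynomials over `L`
  let E : MvPolynomial (Fin 1) L ≃+* Polynomial L :=
    (finSuccEquiv L 0).toRingEquiv.trans (Polynomial.mapEquiv (isEmptyAlgEquiv L (Fin 0)).toRingEquiv)
  have hirr' : Irreducible (E φ) := (MulEquiv.irreducible_iff E.toMulEquiv).mpr hirr
  have hdeg1 := IsAlgClosed.degree_eq_one_of_irreducible L hirr'
  have hnat : (E φ).natDegree = φ.totalDegree := by
    change (Polynomial.map _ (finSuccEquiv L 0 φ)).natDegree = _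
    rw [Polynomial.natDegree_map_eq_of_injective (isEmptyAlgEquiv L (Fin 0)).injective,
      natDegree_finSuccEquiv]
    apply le_antisymm (degreeOf_le_totalDegree _ _)
    rw [totalDegree, degreeOf_eq_sup]
    refine Finset.sup_le fun m hm => ?_
    have : (m.sum fun _ e => e) = m 0 := by
      rw [Finsupp.sum_fintype _ _ (fun _ => rfl), Fin.sum_univ_one]
    rw [this]
    exact Finset.le_sup (f := fun m : Fin 1 →₀ ℕ => m 0) hm
  rw [← hnat]
  exact (Polynomial.natDegree_eq_of_degree_eq_some hdeg1).le

end Irreducible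

/-! ### Corollary 2B (Ostrowski) -/

section Main

/-- Evaluating an integer polynomial at integers and then casting is evaluating at the casts
("the forms … are independent of the field", remark after Thm. 1A). [folklore] -/
theorem cast_eval_eq_aeval {R : Type*} [CommRing R] {ι : Type*} (a : ι → ℤ)
    (γ : MvPolynomial ι ℤ) :
    ((MvPolynomial.eval a γ : ℤ) : R) = aeval (fun i => ((a i : ℤ) : R)) γ := by
  have h := MvPolynomial.eval₂_comp_left (Int.castRingHom R) (RingHom.id ℤ) a γ
  rw [RingHom.comp_id] at h
  rw [MvPolynomial.aeval_def, algebraMap_int_eq]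
  exact h

/-- **Corollary 2B (Ostrowski 1919)**, Schmidt, *Equations over finite fields*, Ch. V: the named
fact `ostrowski1919_absIrreducible_reduction` holds. Let `f ∈ ℤ[X₁, …, Xₙ]` have degree `d > 0` and
be absolutely irreducible; if `p` is a prime with `p > (4‖f‖)^{k^{2^k}}`, `k = C(n+d-1, n)`, then
`f mod p` has degree `d` and is absolutely irreducible. [cite: Schmidt1976, Ch. V Cor. 2B] -/
theorem ostrowski1919_absIrreducible_reduction_holds : ostrowski1919_absIrreducible_reduction := by
  intro N d f hd hfd habs p hp hbound
  classical
  have hf0 : f ≠ 0 := fun h => by rw [h, totalDegree_zero] at hfd; omega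
  have hH : 1 ≤ l1Norm f := one_le_l1Norm hf0
  have hk1 : 1 ≤ (N + d - 1).choose N := Nat.choose_pos (by omega)
  -- an integer `z ≠ 0` with `|z| < p` is non-zero modulo `p`
  have hzmod : ∀ z : ℤ, z ≠ 0 → z.natAbs < p → (z : ZMod p) ≠ 0 := by
    intro z hz hlt h
    rw [ZMod.intCast_zmod_eq_zero_iff_dvd] at h
    exact hz (Int.eq_zero_of_dvd_of_natAbs_lt_natAbs h (by simpa using hlt))
  have hp_gt_norm : l1Norm f < p := by
    calc l1Norm f ≤ 4 * l1Norm f := Nat.le_mul_of_pos_left _ (by norm_num)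
      _ ≤ (4 * l1Norm f) ^ (N + d - 1).choose N ^ 2 ^ (N + d - 1).choose N :=
          Nat.le_self_pow (Nat.pos_iff_ne_zero.mp (Nat.one_le_pow _ _ hk1)) _
      _ < p := hbound
  -- the reduction has degree `d`
  have hcoeffp : ∀ m, coeff m (MvPolynomial.map (Int.castRingHom (ZMod p)) f) =
      ((coeff m f : ℤ) : ZMod p) := fun m => coeff_map _ _ _
  have hsupp : ∀ m ∈ f.support, m ∈ (MvPolynomial.map (Int.castRingHom (ZMod p)) f).support := by
    intro m hm
    rw [mem_support_iff, hcoeffp]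
    exact hzmod _ (mem_support_iff.mp hm) ((natAbs_coeff_le_l1Norm f m).trans_lt hp_gt_norm)
  have hdegp : (MvPolynomial.map (Int.castRingHom (ZMod p)) f).totalDegree = d := by
    apply le_antisymm ((Finset.sup_mono (support_map_subset _ f)).trans hfd.le)
    obtain ⟨m, hm, hmdeg⟩ := exists_mem_support_degree_eq hf0
    rw [hfd] at hmdeg
    have h1 := le_totalDegree (hsupp m hm)
    rw [Finsupp.sum, ← Finsupp.degree_apply, hmdeg] at h1
    exact h1
  refine ⟨hdegp, ?_⟩
  -- absolute irreducibility of the reduction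
  unfold IsAbsIrreducible at habs ⊢
  have hdegP : (MvPolynomial.map (algebraMap (ZMod p) (AlgebraicClosure (ZMod p)))
      (MvPolynomial.map (Int.castRingHom (ZMod p)) f)).totalDegree = d := by
    rw [totalDegree, support_map_of_injective _
      (algebraMap (ZMod p) (AlgebraicClosure (ZMod p))).injective, ← totalDegree, hdegp]
  -- `d = e + 1`
  obtain ⟨e, rfl⟩ : ∃ e, d = e + 1 := ⟨d - 1, by omega⟩
  rcases Nat.eq_zero_or_pos e with he | he
  · -- `d = 1`: a polynomial of degree one is irreducible
    subst he
    exact irreducible_of_totalDegree_eq_one hdegP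
  -- from now on `d ≥ 2`
  have hdegQ : (MvPolynomial.map (Int.castRingHom (AlgebraicClosure ℚ)) f).totalDegree = e + 1 := by
    rw [totalDegree, support_map_of_injective _ (Int.castRingHom (AlgebraicClosure ℚ)).injective_int,
      ← totalDegree, hfd]
  have hφQ : ∀ i : ℚ →+* AlgebraicClosure ℚ, MvPolynomial.map i
      (MvPolynomial.map (Int.castRingHom ℚ) f) =
      MvPolynomial.map (Int.castRingHom (AlgebraicClosure ℚ)) f := by
    intro i
    rw [map_map, RingHom.ext_int (i.comp (Int.castRingHom ℚ)) (Int.castRingHom _)]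
  rw [hφQ] at habs
  rcases Nat.lt_or_ge N 2 with hN | hN
  · -- `n ≤ 1`: no absolutely irreducible polynomial of degree `≥ 2` (vacuous cases)
    exfalso
    interval_cases N
    · -- no variables: `f` is constant
      rw [eq_C_of_isEmpty f, totalDegree_C] at hfd
      omega
    · -- one variable
      have := totalDegree_le_one_of_irreducible_fin_one habs
      omega
  -- main case: `n ≥ 2`, `d ≥ 2`, so `k ≥ 3`
  have hk3 : 3 ≤ (N + (e + 1) - 1).choose N := three_le_choose hN (by omega)
  have hNe : N + (e + 1) - 1 = N + e := by omega
  rw [hNe] at hbound hk3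
  obtain ⟨S, hS, hiff⟩ := noether_forms_exist N e (by omega) he
  -- Theorem 2A over `ℚ̄`: some form does not vanish at the coefficients of `f`
  have hnoQ := not_redOrDegLt_of_irreducible habs hdegQ
  rw [hiff (AlgebraicClosure ℚ) _ hdegQ.le] at hnoQ
  push Not at hnoQ
  obtain ⟨γ, hγS, hγ⟩ := hnoQ
  -- the integer `z = γ(a)`; note `ℤ`-algebra structures on `K̄` need not be syntactically the
  -- canonical one, so we compare through `eval₂ (Int.castRingHom _)`
  set z : ℤ := MvPolynomial.eval (fun m => coeff m f) γ with hz
  have halgQ : ∀ inst : Algebra ℤ (AlgebraicClosure ℚ),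
      @algebraMap ℤ (AlgebraicClosure ℚ) _ _ inst = Int.castRingHom _ := fun _ => RingHom.ext_int _ _
  have hcastQ := cast_eval_eq_aeval (R := AlgebraicClosure ℚ) (fun m => coeff m f) γ
  simp only [MvPolynomial.aeval_def, halgQ] at hcastQ
  simp only [coeff_map, eq_intCast, MvPolynomial.aeval_def, halgQ] at hγ
  rw [← hcastQ, ← hz] at hγ
  have hz0 : z ≠ 0 := fun h => hγ (by rw [h, Int.cast_zero])
  -- `0 < |z| ≤ ‖γ‖ ‖f‖^{deg γ} ≤ (4 ‖f‖)^{k^{2^k}} < p`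
  obtain ⟨hγdeg, hγnorm⟩ := hS γ hγS
  have hzlt : z.natAbs < p := by
    calc z.natAbs ≤ l1Norm γ * l1Norm f ^ (N + e).choose N ^ 2 ^ (N + e).choose N :=
          natAbs_eval_le γ _ (l1Norm f) hH (natAbs_coeff_le_l1Norm f) _
            (hγdeg.trans (noether_degree_le hk3))
      _ ≤ 4 ^ (N + e).choose N ^ 2 ^ (N + e).choose N *
            l1Norm f ^ (N + e).choose N ^ 2 ^ (N + e).choose N :=
          Nat.mul_le_mul_right _ (hγnorm.trans (noether_norm_le hk3))
      _ = (4 * l1Norm f) ^ (N + e).choose N ^ 2 ^ (N + e).choose N := (mul_pow _ _ _).symm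
      _ < p := hbound
  -- Theorem 2A over `𝔽̄_p`: `γ` does not vanish at the coefficients of `f mod p`
  refine irreducible_of_not_redOrDegLt hdegP fun hred => ?_
  have h0 := (hiff (AlgebraicClosure (ZMod p)) _ hdegP.le).mp hred γ hγS
  have halgP : ∀ inst : Algebra ℤ (AlgebraicClosure (ZMod p)),
      @algebraMap ℤ (AlgebraicClosure (ZMod p)) _ _ inst = Int.castRingHom _ :=
    fun _ => RingHom.ext_int _ _
  have hcastP := cast_eval_eq_aeval (R := AlgebraicClosure (ZMod p)) (fun m => coeff m f) γ
  simp only [MvPolynomial.aeval_def, halgP] at hcastP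
  simp only [coeff_map, eq_intCast, map_intCast, MvPolynomial.aeval_def, halgP] at h0
  rw [← hcastP, ← hz, ← map_intCast (algebraMap (ZMod p) (AlgebraicClosure (ZMod p))) z,
    map_eq_zero_iff _ (algebraMap (ZMod p) (AlgebraicClosure (ZMod p))).injective] at h0
  exact hzmod z hz0 hzlt h0

end Main

end Literature.RingTheory.MvPolynomial
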